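import Mathlib
import Literature.Analysis.Convex.ConvexMetricProjection
import Literature.Analysis.Convex.ConicCaratheodory
import Literature.Analysis.Convex.LinearProgrammingDuality
import HarnessLib

/-!
# Hoffman's error bound for systems of linear inequalities (Hoffman 1952)

Topic `Literature/Analysis/Convex` (uses the tree's metric projection `ConvexMetricProjection.proj`
[Deutsch2001, Thm 4.1], Carathéodory's theorem for cones `caratheodory_cone` [Schrijver1986,
Cor 7.1i] and Farkas' lemma `LPDuality.farkas_nonneg_eq` [Schrijver1986, Cor 7.1d]). Namespace
`Literature.Analysis.Convex.HoffmanErrorBound`. Everything PROVED; no named facts.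

Sources. A. J. Hoffman, *On approximate solutions of systems of linear inequalities*, J. Research
Nat. Bur. Standards 49 (1952) 263–265, doi:10.6028/jres.049.027 [Hoffman1952] (held, `lit` key
`paper:doi-10-6028-jres-049-027`; read p. 263: the Theorem and Lemmas 1–3 (Agmon)). J. Peña,
J. C. Vera, L. F. Zuluaga, *New characterizations of Hoffman constants for systems of linear
constraints*, Math. Program. 187 (2021) 79–109 = arXiv:1905.02894 [PenaVeraZuluaga2020] (held,
`paper:arxiv-1905.02894`; read §1 (1)–(2): the modern statement "for `A ∈ ℝ^{m×n}` there exists a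
Hoffman constant `H(A)` that depends only on `A` such that for all `b ∈ A(ℝⁿ) + ℝ^m_+` and all
`u ∈ ℝⁿ`, `dist(u, P_A(b)) ≤ H(A) · ‖(Au − b)_+‖`" and the popular characterization
`H(A) = max_{J : A_J full row rank} 1 / min_{v ∈ ℝ^J_+, ‖v‖* = 1} ‖A_Jᵀ v‖*`).

THE PRINTED STATEMENT [Hoffman1952, Theorem]: "Let (1) be a consistent system of inequalities and let
`F_n` and `F_m` each satisfy (3). Then there exists a constant `c > 0` such that for any `x` there
exists a solution `x₀` of (1) with `F_n(x − x₀) ≤ c F_m((Ax − b)⁺)`." (`(Ax − b)⁺` the positive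
part, `F_n`, `F_m` positively homogeneous continuous gauges.) Hoffman's proof: `x₀` = the nearest
solution, [Lemma 2] (Agmon) the active subsystem `S` at `x₀` already has `x₀` as nearest point to
`x`, [Lemma 3] a compactness constant for each of the finitely many active patterns.

WHAT IS TYPED (a finite family of normals `a : ι → E` in a finite-dimensional real inner product
space `E`, `F_n` = the norm of `E`, `F_m` = the `ℓ¹` (or `ℓ^∞`) size of the residual vector):

* `polyhedron a b = {x | ∀ i, ⟨aᵢ, x⟩ ≤ bᵢ}` (closed, convex), `residual a b x i = (⟨aᵢ, x⟩ − bᵢ)₊`.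
* `exists_nonneg_sum_smul_eq` — the conic Farkas alternative inside `E` (coordinates in
  `stdOrthonormalBasis` + [Schrijver1986, Cor 7.1d]).
* **`exists_active_multipliers`** — Agmon's Lemma 2 in multiplier form: at the nearest point `p`
  (variational inequality), `x − p = Σ λᵢ aᵢ` with `λ ≥ 0` supported on the ACTIVE rows.
* `exists_norm_le_mul_norm_sum_smul`, `exists_uniform_norm_le` — Lemma 3's constants: on linearly
  independent rows the coefficients are bounded by the combination, uniformly over the finitely many
  row sets (finite dimension).
* **`hoffman`** — the Theorem as printed (attained form `∃ x₀ ∈ P_A(b)`), with ONE constant for all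
  consistent right-hand sides `b`; `hoffman_infDist` (`dist(x, P_A(b)) ≤ H Σᵢ (⟨aᵢ,x⟩ − bᵢ)₊`) and
  `hoffman_sup` (`≤ |ι|·H · maxᵢ (⟨aᵢ,x⟩ − bᵢ)₊`).

The constant produced, `Σ_{s : rows independent} ‖(A_sᵀ)⁻¹|_{range}‖`, dominates the sharp constant of
the popular characterization [PenaVeraZuluaga2020, (2)]; sharpness of the constant, the relative
version `H(A|R)` and the equality-constrained variants of [PenaVeraZuluaga2020, §2–§3] are NOT typed.
Equality constraints are covered by writing `⟨a, x⟩ = β` as two inequalities.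
-/

namespace Literature.Analysis.Convex.HoffmanErrorBound

open scoped RealInnerProductSpace
open Filter Topology
open Literature.Analysis.Convex.ConvexMetricProjection (proj proj_mem inner_sub_proj_le_zero)

variable {E : Type*} [NormedAddCommGroup E] [InnerProductSpace ℝ E] [FiniteDimensional ℝ E]
variable {ι : Type*} [Fintype ι]

/-! ### The polyhedron and its residual -/

/-- The polyhedron `P_A(b) = {x : ⟨aᵢ, x⟩ ≤ bᵢ for all i}` of a finite system of linear inequalities
with normals `a : ι → E`. [cite: Hoffman1952, §1 (the system Σ_j a_ij x_j ≤ b_i)]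
[cite: PenaVeraZuluaga2020, §1 (P_A(b) := {x : Ax ≤ b})] -/
def polyhedron (a : ι → E) (b : ι → ℝ) : Set E := {x | ∀ i, ⟪a i, x⟫ ≤ b i}

omit [FiniteDimensional ℝ E] [Fintype ι] in
/-- Membership in `P_A(b)`. [cite: PenaVeraZuluaga2020, §1] -/
theorem mem_polyhedron_iff (a : ι → E) (b : ι → ℝ) (x : E) :
    x ∈ polyhedron a b ↔ ∀ i, ⟪a i, x⟫ ≤ b i := Iff.rfl

omit [FiniteDimensional ℝ E] [Fintype ι] in
/-- `P_A(b)` is closed (an intersection of closed half-spaces).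
[cite: BoydVandenberghe2004, §2.2.4 (polyhedra: intersections of finitely many halfspaces)] -/
theorem isClosed_polyhedron (a : ι → E) (b : ι → ℝ) : IsClosed (polyhedron a b) := by
  have h : polyhedron a b = ⋂ i, {x | ⟪a i, x⟫ ≤ b i} := by
    ext x; simp [polyhedron]
  rw [h]
  exact isClosed_iInter fun i => isClosed_le (continuous_const.inner continuous_id) continuous_const

omit [FiniteDimensional ℝ E] [Fintype ι] in
/-- `P_A(b)` is convex ("polyhedra are convex sets").
[cite: BoydVandenberghe2004, §2.2.4 (polyhedra)] -/
theorem convex_polyhedron (a : ι → E) (b : ι → ℝ) : Convex ℝ (polyhedron a b) := by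
  have h : polyhedron a b = ⋂ i, {x | ⟪a i, x⟫ ≤ b i} := by
    ext x; simp [polyhedron]
  rw [h]
  refine convex_iInter fun i => ?_
  have hl : IsLinearMap ℝ fun x : E => ⟪a i, x⟫ := (innerSL ℝ (a i)).toLinearMap.isLinear
  exact convex_halfSpace_le hl (b i)

/-- The (positive part of the) residual of `x` in the `i`-th inequality, `(⟨aᵢ, x⟩ − bᵢ)₊`.
[cite: PenaVeraZuluaga2020, §1 ((Au − b)_+ := max(0, Au − b))] -/
noncomputable def residual (a : ι → E) (b : ι → ℝ) (x : E) (i : ι) : ℝ := max (⟪a i, x⟫ - b i) 0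

omit [FiniteDimensional ℝ E] [Fintype ι] in
/-- The residual is nonnegative. [cite: PenaVeraZuluaga2020, §1] -/
theorem residual_nonneg (a : ι → E) (b : ι → ℝ) (x : E) (i : ι) : 0 ≤ residual a b x i :=
  le_max_right _ _

omit [FiniteDimensional ℝ E] [Fintype ι] in
/-- The residual dominates the signed violation. [cite: PenaVeraZuluaga2020, §1] -/
theorem sub_le_residual (a : ι → E) (b : ι → ℝ) (x : E) (i : ι) :
    ⟪a i, x⟫ - b i ≤ residual a b x i :=
  le_max_left _ _

omit [FiniteDimensional ℝ E] [Fintype ι] in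
/-- On the polyhedron the residual vanishes. [cite: PenaVeraZuluaga2020, §1] -/
theorem residual_eq_zero_of_mem (a : ι → E) (b : ι → ℝ) {x : E} (hx : x ∈ polyhedron a b) (i : ι) :
    residual a b x i = 0 :=
  max_eq_right (by linarith [hx i])

/-! ### Farkas' lemma in an inner product space (via an orthonormal basis and the tree's
Schrijver Cor. 7.1d) -/

omit [Fintype ι] in
/-- **Conic Farkas alternative in `E`**: if `⟨g, d⟩ ≥ 0` for every `d` with `⟨w_k, d⟩ ≥ 0` for all
`k ∈ s`, then `g` is a nonnegative combination of the `w_k`, `k ∈ s`. (Coordinates in an orthonormal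
basis reduce this to [Schrijver1986, Cor. 7.1d] = `LPDuality.farkas_nonneg_eq`.)
[cite: Schrijver1986, Cor 7.1d (p. 89)] -/
theorem exists_nonneg_sum_smul_eq [DecidableEq ι] (s : Finset ι) (w : ι → E) (g : E)
    (h : ∀ d : E, (∀ k ∈ s, 0 ≤ ⟪w k, d⟫) → 0 ≤ ⟪g, d⟫) :
    ∃ y : ι → ℝ, (∀ k, 0 ≤ y k) ∧ (∀ k, k ∉ s → y k = 0) ∧ ∑ k ∈ s, y k • w k = g := by
  classical
  set B := stdOrthonormalBasis ℝ E with hB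
  set m := Module.finrank ℝ E with hm
  -- coordinates: rows = basis index, columns = generators in `s`
  let A : Matrix (Fin m) s ℝ := fun j k => B.repr (w k) j
  let bv : Fin m → ℝ := fun j => B.repr g j
  have hinner : ∀ (v : E) (c : Fin m → ℝ), ⟪v, ∑ j, c j • B j⟫ = ∑ j, c j * B.repr v j := by
    intro v c
    rw [inner_sum]
    refine Finset.sum_congr rfl fun j _ => ?_
    rw [real_inner_smul_right, B.repr_apply_apply, real_inner_comm]
  obtain ⟨y, hy, hAy⟩ := (LPDuality.farkas_nonneg_eq A bv).2 (by
    intro c hc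
    set d : E := ∑ j, c j • B j with hd
    have h1 : ∀ k ∈ s, 0 ≤ ⟪w k, d⟫ := by
      intro k hk
      have hck := hc ⟨k, hk⟩
      simp only [Pi.zero_apply, Matrix.vecMul, dotProduct, A] at hck
      rw [hd, hinner]
      exact hck
    have h2 := h d h1
    rw [hd, hinner] at h2
    simpa [dotProduct, bv] using h2)
  -- extend the multipliers by zero off `s`
  refine ⟨fun k => if hk : k ∈ s then y ⟨k, hk⟩ else 0, fun k => ?_, fun k hk => ?_, ?_⟩
  · by_cases hk : k ∈ s
    · simp only [hk, dite_true]; exact hy _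
    · simp [hk]
  · simp [hk]
  · -- compare coordinates in the orthonormal basis
    have hsum : ∑ k ∈ s, (fun k => if hk : k ∈ s then y ⟨k, hk⟩ else 0) k • w k =
        ∑ k : s, y k • w (k : ι) := by
      rw [← Finset.sum_coe_sort]
      refine Finset.sum_congr rfl fun k _ => ?_
      simp only [k.2, dite_true]
    rw [hsum]
    refine B.toBasis.ext_elem fun j => ?_
    rw [B.coe_toBasis_repr_apply, B.coe_toBasis_repr_apply, B.repr_apply_apply,
      B.repr_apply_apply, inner_sum]
    have hj := congrFun hAy j
    simp only [Matrix.mulVec, dotProduct, A, bv, B.repr_apply_apply] at hj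
    rw [← hj]
    refine Finset.sum_congr rfl fun k _ => ?_
    rw [real_inner_smul_right, mul_comm]

/-! ### KKT multipliers at the projection: `x − P(x) ∈ cone{aᵢ : i active}` -/

/-- **The normal cone of a polyhedron is generated by the active constraints.** If `p ∈ P_A(b)`
satisfies the variational inequality `⟨x − p, y − p⟩ ≤ 0` for all `y ∈ P_A(b)` (i.e. `p` is the
projection of `x`), then `x − p = Σᵢ λᵢ aᵢ` with `λ ≥ 0` supported on the active set
`{i : ⟨aᵢ, p⟩ = bᵢ}`. Proof: by Farkas it suffices that `⟨x − p, d⟩ ≥ 0` whenever `⟨aᵢ, d⟩ ≥ 0` for all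
active `i`; for such `d` the points `p − εd`, `ε > 0` small, stay in the polyhedron (active rows by
sign, inactive rows by continuity), and the variational inequality at `y = p − εd` gives it.
[cite: Hoffman1952, §2 (the active subsystem at the nearest point)] [cite: Schrijver1986, Cor 7.1d (p. 89)] -/
theorem exists_active_multipliers [DecidableEq ι] (a : ι → E) (b : ι → ℝ) {x p : E}
    (hp : p ∈ polyhedron a b) (hvi : ∀ y ∈ polyhedron a b, ⟪x - p, y - p⟫ ≤ 0) :
    ∃ lam : ι → ℝ, (∀ i, 0 ≤ lam i) ∧ (∀ i, ⟪a i, p⟫ ≠ b i → lam i = 0) ∧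
      ∑ i ∈ Finset.univ.filter (fun i => ⟪a i, p⟫ = b i), lam i • a i = x - p := by
  classical
  set s := Finset.univ.filter (fun i => ⟪a i, p⟫ = b i) with hs
  have hfar : ∀ d : E, (∀ k ∈ s, 0 ≤ ⟪a k, d⟫) → 0 ≤ ⟪x - p, d⟫ := by
    intro d hd
    -- `p − ε d ∈ P_A(b)` for all small `ε > 0`
    have hev : ∀ᶠ ε in 𝓝[>] (0 : ℝ), ∀ i, ⟪a i, p - ε • d⟫ ≤ b i := by
      rw [Filter.eventually_all]
      intro i
      by_cases hi : ⟪a i, p⟫ = b i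
      · refine eventually_nhdsWithin_of_forall fun ε hε => ?_
        have hε' : 0 < ε := hε
        have hk := hd i (by rw [hs, Finset.mem_filter]; exact ⟨Finset.mem_univ _, hi⟩)
        rw [inner_sub_right, real_inner_smul_right, hi]
        nlinarith
      · have hlt : ⟪a i, p⟫ < b i := lt_of_le_of_ne (hp i) hi
        have hcont : ContinuousAt (fun ε : ℝ => ⟪a i, p - ε • d⟫) 0 := by fun_prop
        have h0 : (fun ε : ℝ => ⟪a i, p - ε • d⟫) 0 < (fun _ : ℝ => b i) 0 := by simpa using hlt
        have hev' : ∀ᶠ ε in 𝓝 (0 : ℝ), ⟪a i, p - ε • d⟫ < b i :=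
          hcont.eventually_lt continuousAt_const h0
        exact (hev'.filter_mono nhdsWithin_le_nhds).mono fun ε h => h.le
    obtain ⟨ε, hεP, hεpos⟩ := (hev.and self_mem_nhdsWithin).exists
    have hε : 0 < ε := hεpos
    have hy := hvi (p - ε • d) hεP
    rw [sub_sub_cancel_left, inner_neg_right, real_inner_smul_right] at hy
    nlinarith
  obtain ⟨lam, hlam0, hoff, hsum⟩ := exists_nonneg_sum_smul_eq s a (x - p) hfar
  refine ⟨lam, hlam0, fun i hi => hoff i ?_, hsum⟩
  rw [hs, Finset.mem_filter]
  exact fun h => hi h.2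

/-! ### Linearly independent rows: the coefficients are controlled by the combination -/

omit [FiniteDimensional ℝ E] in
/-- For a linearly independent subfamily `(aᵢ)_{i ∈ s}` the coefficient vector is bounded by the
combination: there is `K ≥ 0` with `‖y‖ ≤ K ‖Σ_{i∈s} yᵢ aᵢ‖` for all `y : s → ℝ` (finite dimension:
an injective linear map is bounded below; `K = ‖(A_sᵀ|_{range})⁻¹‖`). This is the reciprocal of the
quantity `min_{‖v‖=1} ‖A_Jᵀ v‖` entering the popular characterization of Hoffman's constant.
[cite: PenaVeraZuluaga2020, §1 (2) (the characterization over full-row-rank J)] -/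
theorem exists_norm_le_mul_norm_sum_smul (a : ι → E) {s : Finset ι} (hs : LinearIndepOn ℝ a s) :
    ∃ K : ℝ, 0 ≤ K ∧ ∀ y : s → ℝ, ‖y‖ ≤ K * ‖∑ k : s, y k • a (k : ι)‖ := by
  let f : (s → ℝ) →ₗ[ℝ] E := Fintype.linearCombination ℝ (fun k : s => a (k : ι))
  have hli : LinearIndependent ℝ (fun k : s => a (k : ι)) := hs
  have hinj : Function.Injective f := by
    rw [← LinearMap.ker_eq_bot, LinearMap.ker_eq_bot']
    intro y hy
    have hy' : ∑ k, y k • a (k : ι) = 0 := by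
      simpa [f, Fintype.linearCombination_apply] using hy
    exact funext (Fintype.linearIndependent_iff.mp hli y hy')
  let e : (s → ℝ) ≃L[ℝ] LinearMap.range f := (LinearEquiv.ofInjective f hinj).toContinuousLinearEquiv
  refine ⟨‖(e.symm : LinearMap.range f →L[ℝ] (s → ℝ))‖, ContinuousLinearMap.opNorm_nonneg _,
    fun y => ?_⟩
  have h1 : e.symm (e y) = y := e.symm_apply_apply y
  have h2 : ‖e y‖ = ‖∑ k : s, y k • a (k : ι)‖ := by
    have : ((e y : LinearMap.range f) : E) = f y := by
      simp [e, LinearEquiv.ofInjective_apply]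
    rw [Submodule.coe_norm, this]
    simp [f, Fintype.linearCombination_apply]
  calc ‖y‖ = ‖e.symm (e y)‖ := by rw [h1]
    _ ≤ ‖(e.symm : LinearMap.range f →L[ℝ] (s → ℝ))‖ * ‖e y‖ :=
        (e.symm : LinearMap.range f →L[ℝ] (s → ℝ)).le_opNorm _
    _ = ‖(e.symm : LinearMap.range f →L[ℝ] (s → ℝ))‖ * ‖∑ k : s, y k • a (k : ι)‖ := by rw [h2]

omit [FiniteDimensional ℝ E] in
/-- A uniform constant over all linearly independent subfamilies (there are finitely many).
[cite: PenaVeraZuluaga2020, §1 (2) (max over full-row-rank J)] -/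
theorem exists_uniform_norm_le (a : ι → E) :
    ∃ H : ℝ, 0 ≤ H ∧ ∀ s : Finset ι, LinearIndepOn ℝ a s →
      ∀ y : s → ℝ, ‖y‖ ≤ H * ‖∑ k : s, y k • a (k : ι)‖ := by
  classical
  have hK : ∀ s : Finset ι, ∃ K : ℝ, 0 ≤ K ∧ (LinearIndepOn ℝ a s →
      ∀ y : s → ℝ, ‖y‖ ≤ K * ‖∑ k : s, y k • a (k : ι)‖) := by
    intro s
    by_cases hs : LinearIndepOn ℝ a s
    · obtain ⟨K, hK0, hK⟩ := exists_norm_le_mul_norm_sum_smul a hs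
      exact ⟨K, hK0, fun _ => hK⟩
    · exact ⟨0, le_rfl, fun h => absurd h hs⟩
  choose K hK0 hK using hK
  refine ⟨∑ s : Finset ι, K s, Finset.sum_nonneg fun s _ => hK0 s, fun s hs y => ?_⟩
  have hle : K s ≤ ∑ s : Finset ι, K s :=
    Finset.single_le_sum (fun s _ => hK0 s) (Finset.mem_univ s)
  exact (hK s hs y).trans (mul_le_mul_of_nonneg_right hle (norm_nonneg _))

/-! ### Hoffman's theorem -/

/-- **Hoffman's error bound (Hoffman 1952, Theorem).** "Let (1) `Ax ≤ b` be a consistent system of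
inequalities and let `F_n` and `F_m` each satisfy (3) [positively homogeneous continuous gauges].
Then there exists a constant `c > 0` such that for any `x` there exists a solution `x₀` of (1) with
`F_n(x − x₀) ≤ c F_m((Ax − b)⁺)`." Here: for a finite family of normals `a : ι → E` in a
finite-dimensional real inner product space there is `H = H(a) ≥ 0`, depending only on `a`, such that
for EVERY right-hand side `b` with `P_A(b) = {x : ⟨aᵢ, x⟩ ≤ bᵢ} ≠ ∅` and every `x ∈ E` some
`x₀ ∈ P_A(b)` has `‖x − x₀‖ ≤ H · Σᵢ (⟨aᵢ, x⟩ − bᵢ)₊` (`F_n` = the Euclidean norm, `F_m` = the `ℓ¹`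
norm; cf. "for `A ∈ ℝ^{m×n}` there exists a Hoffman constant `H(A)` that depends only on `A` such that
for all `b ∈ A(ℝⁿ) + ℝ^m_+` and all `u ∈ ℝⁿ`, `dist(u, P_A(b)) ≤ H(A)·‖(Au − b)_+‖`"). Proof (Hoffman's,
via Agmon's nearest-point lemma, in modern dress): project
`x` onto the polyhedron, write `x − p = Σ λᵢ aᵢ` over the active rows (`exists_active_multipliers`),
move the multipliers onto linearly independent active rows by Carathéodory
(`Literature.Analysis.Convex.caratheodory_cone`), and use `‖x − p‖² = Σ λᵢ(⟨aᵢ, x⟩ − bᵢ) ≤ ‖λ‖_∞ Σ (⟨aᵢ,x⟩ − bᵢ)₊`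
together with `‖λ‖_∞ ≤ K_s ‖x − p‖` (`exists_uniform_norm_le`). The constant produced dominates the
sharp Hoffman constant of the popular characterization `max_{J : A_J full row rank} 1/min ‖A_Jᵀ v‖`.
[cite: Hoffman1952, Theorem (§1)] [cite: PenaVeraZuluaga2020, §1 (1)–(2)] -/
theorem hoffman (a : ι → E) :
    ∃ H : ℝ, 0 ≤ H ∧ ∀ b : ι → ℝ, (polyhedron a b).Nonempty → ∀ x : E,
      ∃ x₀ ∈ polyhedron a b, ‖x - x₀‖ ≤ H * ∑ i, residual a b x i := by
  classical
  obtain ⟨H, hH0, hH⟩ := exists_uniform_norm_le a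
  refine ⟨H, hH0, fun b hne x => ?_⟩
  set P := polyhedron a b with hPdef
  have hPc : IsComplete P := (isClosed_polyhedron a b).isComplete
  have hPconv : Convex ℝ P := convex_polyhedron a b
  set p := proj P x with hpdef
  have hpP : p ∈ P := proj_mem hne hPc hPconv x
  have hV0 : 0 ≤ ∑ i, residual a b x i := Finset.sum_nonneg fun i _ => residual_nonneg a b x i
  refine ⟨p, hpP, ?_⟩
  -- KKT multipliers on the active rows, then Carathéodory
  obtain ⟨lam, hlam0, -, hsum⟩ :=
    exists_active_multipliers a b hpP (fun y hy => inner_sub_proj_le_zero hne hPc hPconv x hy)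
  set t := Finset.univ.filter (fun i => ⟪a i, p⟫ = b i) with ht
  obtain ⟨s, hst, hsli, c, hcpos, hcsum⟩ :=
    caratheodory_cone a t lam (fun i _ => hlam0 i)
  rw [hsum] at hcsum
  -- `hcsum : Σ_{i∈s} c i • a i = x − p`, `c > 0` on `s`, rows of `s` independent and active
  have hact : ∀ i ∈ s, ⟪a i, p⟫ = b i := by
    intro i hi
    have := hst hi
    rw [ht, Finset.mem_filter] at this
    exact this.2
  -- the coefficient vector on `s` and its bound
  set ys : s → ℝ := fun k => c k with hys
  have hysum : ∑ k : s, ys k • a (k : ι) = x - p := by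
    rw [← hcsum]
    exact Finset.sum_coe_sort s (fun i => c i • a i)
  have hyle : ‖ys‖ ≤ H * ‖x - p‖ := by
    have h := hH s hsli ys
    rwa [hysum] at h
  have hci : ∀ i (hi : i ∈ s), c i ≤ ‖ys‖ := by
    intro i hi
    calc c i ≤ |c i| := le_abs_self _
      _ = ‖ys ⟨i, hi⟩‖ := by simp [hys, Real.norm_eq_abs]
      _ ≤ ‖ys‖ := norm_le_pi_norm ys ⟨i, hi⟩
  -- the key estimate `‖x − p‖² ≤ ‖ys‖ · Σ residual`
  have hkey : ‖x - p‖ ^ 2 ≤ ‖ys‖ * ∑ i, residual a b x i := by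
    have h1 : ‖x - p‖ ^ 2 = ∑ i ∈ s, c i * ⟪a i, x - p⟫ := by
      rw [← real_inner_self_eq_norm_sq]
      conv_lhs => rw [← hcsum]
      rw [sum_inner]
      exact Finset.sum_congr rfl fun i _ => by rw [real_inner_smul_left, hcsum]
    have h2 : ∀ i ∈ s, c i * ⟪a i, x - p⟫ ≤ ‖ys‖ * residual a b x i := by
      intro i hi
      have e : ⟪a i, x - p⟫ = ⟪a i, x⟫ - b i := by rw [inner_sub_right, hact i hi]
      rw [e]
      have hr := sub_le_residual a b x i
      have hr0 := residual_nonneg a b x i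
      have hc0 : 0 ≤ c i := (hcpos i hi).le
      calc c i * (⟪a i, x⟫ - b i) ≤ c i * residual a b x i := mul_le_mul_of_nonneg_left hr hc0
        _ ≤ ‖ys‖ * residual a b x i := mul_le_mul_of_nonneg_right (hci i hi) hr0
    calc ‖x - p‖ ^ 2 = ∑ i ∈ s, c i * ⟪a i, x - p⟫ := h1
      _ ≤ ∑ i ∈ s, ‖ys‖ * residual a b x i := Finset.sum_le_sum h2
      _ ≤ ∑ i, ‖ys‖ * residual a b x i :=
          Finset.sum_le_sum_of_subset_of_nonneg (Finset.subset_univ s)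
            (fun i _ _ => mul_nonneg (norm_nonneg _) (residual_nonneg a b x i))
      _ = ‖ys‖ * ∑ i, residual a b x i := by rw [Finset.mul_sum]
  -- conclude
  have hnp : 0 ≤ ‖x - p‖ := norm_nonneg _
  rcases hnp.eq_or_lt with h0 | hpos
  · rw [← h0]
    exact mul_nonneg hH0 hV0
  · have h3 : ‖x - p‖ ^ 2 ≤ H * ‖x - p‖ * ∑ i, residual a b x i :=
      hkey.trans (mul_le_mul_of_nonneg_right hyle hV0)
    have : ‖x - p‖ * ‖x - p‖ ≤ ‖x - p‖ * (H * ∑ i, residual a b x i) := by nlinarith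
    exact le_of_mul_le_mul_left this hpos

/-- **Hoffman's bound for the distance**: `dist(x, P_A(b)) ≤ H · Σᵢ (⟨aᵢ, x⟩ − bᵢ)₊` with a constant
depending only on `a`, uniformly in the right-hand side `b` (as long as `P_A(b) ≠ ∅`).
[cite: Hoffman1952, Theorem (§1)] [cite: PenaVeraZuluaga2020, §1 (1)] -/
theorem hoffman_infDist (a : ι → E) :
    ∃ H : ℝ, 0 ≤ H ∧ ∀ b : ι → ℝ, (polyhedron a b).Nonempty → ∀ x : E,
      Metric.infDist x (polyhedron a b) ≤ H * ∑ i, residual a b x i := by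
  obtain ⟨H, hH0, hH⟩ := hoffman a
  refine ⟨H, hH0, fun b hne x => ?_⟩
  obtain ⟨x₀, hx₀, hle⟩ := hH b hne x
  have h := Metric.infDist_le_dist_of_mem (x := x) hx₀
  rw [dist_eq_norm] at h
  exact h.trans hle

/-- **Hoffman's bound with the largest violation** (`ℓ^∞` residual): with the same kind of
constant, `dist(x, P_A(b)) ≤ H' · maxᵢ (⟨aᵢ, x⟩ − bᵢ)₊`, `H' = |ι|·H`.
[cite: Hoffman1952, Theorem (§1)] [cite: PenaVeraZuluaga2020, §1 (1)] -/
theorem hoffman_sup (a : ι → E) :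
    ∃ H : ℝ, 0 ≤ H ∧ ∀ b : ι → ℝ, (polyhedron a b).Nonempty → ∀ x : E, ∀ R : ℝ,
      (∀ i, residual a b x i ≤ R) → Metric.infDist x (polyhedron a b) ≤ H * R := by
  obtain ⟨H, hH0, hH⟩ := hoffman_infDist a
  refine ⟨Fintype.card ι * H, by positivity, fun b hne x R hR => ?_⟩
  have h1 := hH b hne x
  have h2 : ∑ i, residual a b x i ≤ ∑ _i : ι, R := Finset.sum_le_sum fun i _ => hR i
  rw [Finset.sum_const, Finset.card_univ, nsmul_eq_mul] at h2
  calc Metric.infDist x (polyhedron a b) ≤ H * ∑ i, residual a b x i := h1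
    _ ≤ H * (Fintype.card ι * R) := mul_le_mul_of_nonneg_left h2 hH0
    _ = Fintype.card ι * H * R := by ring

omit [FiniteDimensional ℝ E] [Fintype ι] in
/-- The bound is consistent: on the polyhedron both sides vanish. [cite: PenaVeraZuluaga2020, §1] -/
theorem infDist_eq_zero_of_mem (a : ι → E) (b : ι → ℝ) {x : E} (hx : x ∈ polyhedron a b) :
    Metric.infDist x (polyhedron a b) = 0 :=
  Metric.infDist_zero_of_mem hx

end Literature.Analysis.Convex.HoffmanErrorBound
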